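import Summits.AtomisticToContinuum.HydrodynamicLimit.Theorems.AntiMazurCoboundariesKineticWindowGronwallActivityInversion
import Summits.AtomisticToContinuum.HydrodynamicLimit.Theorems.TwoClocksClampedWindowDockReferenceLLN
import HarnessLib

/-!
# Activity inversion for the kinetic-window entropy ledger, II: uniqueness mod constants in the dilute class

Companion of `AntiMazurCoboundariesKineticWindowGronwallActivityInversion` (crux `KineticWindowGronwall`,
stmt-AtomisticToContinuum-9282, line `dlr-block-transfer` v3, registered stub `stub_pdeAndInversion`, second conjunct
`ActivityInversion`). There, clauses (i)–(iii) of the ledger's hypothesis A are proved for the thermodynamic activity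
`α_σ ∘ ρ` (`thermoActivity`) and the hypothesis is reduced to its clause (iv), uniqueness of the activity mod
constants among ALL continuous positive activities — non-perturbative, open as typed. This file proves clause (iv)
in the DILUTE class and lands the corrected hypothesis as a theorem:

* `rhoLim_mul_insertion` — the cluster-series density through the insertion map: for a profile `Q` in the statics
  regime, `rhoLim Q σ x · Rf(σ³ rhoLim Q σ x) = ratioLimit Q σ · β_Q(x)` (uniqueness of the root of `R Φ(xR) = 1`;
  the pointwise identity behind `EntropyClockDock.activity_of_density`, isolated);
* `thermoActivity_unique` — (iv′): a continuous activity `a' > 0` with the activity-ratio guard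
  `σ³ · sup a' ≤ η₁ ∫ a'` whose local Gibbs laws have density field converging in probability (along some flow
  family) to `ρ` is a constant multiple of `α_σ ∘ ρ`: the guard puts `profileOf a'` in the statics regime, so the
  field converges to `rhoLim (profileOf a') σ` (`EntropyClockDock.densityLLN_of_smallDensity`, 13735 dock III);
  limits in probability are unique (`DenseExcursionAtTimeZero.eq_of_tendsto_measure_lt_abs`), so
  `rhoLim (profileOf a') σ = ρ`, and `rhoLim_mul_insertion` reads `α_σ(ρ(x)) = ρ(x) Rf(σ³ρ(x)) = R' a'(x)/∫a'`;
* `ActivityInversionDilute` — `ActivityInversion` with clause (iv) restricted by that guard (all else verbatim); it is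
  what the entropy ledger consumes at `t = 0`, since `RelEntropyVanishing` chooses `σ₀` AFTER the initial activity
  `a₀` (take `σ₀³ ≤ η₁ ∫a₀ / sup a₀`). Registered helper stub `stub_activityInversionDilute`, PROVED.

Sources: Ruelle 1969 §3.4, Lebowitz–Penrose 1964, Pulvirenti–Tsagkarogiannis 2012, Spohn 1991 Part I §2.3.
-/

noncomputable section

namespace Summit.AtomisticToContinuum.HydrodynamicLimit.Theorems.KineticWindowGronwallActivityInversion

open MeasureTheory Filter Set Topology
open scoped ENNReal
open Literature.MathematicalPhysics.KineticTheory Literature.Analysis.FluidPDE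
open Summit.AtomisticToContinuum.HydrodynamicLimit.Theorems.UniformLGC
open Summit.AtomisticToContinuum.HydrodynamicLimit.Theorems.EntropyClockDock
open Summit.AtomisticToContinuum.HydrodynamicLimit.Theorems.R2OneModeTwoConditions
open Summit.AtomisticToContinuum.HydrodynamicLimit.Theorems.DenseExcursionAtTimeZero

/-! ### §1 The cluster-series density through the insertion factor -/

-- adapted from the proof of `EntropyClockDock.activity_of_density`
-- (Theorems/TwoClocksClampedWindowDockActivityInversion.lean)
/-- **`F_σ ∘ rhoLim = R β`.** For a profile `Q` in the statics regime and a point where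
`σ³ · rhoLim Q σ x ∈ (-r, r)`: `rhoLim Q σ x · Rf(σ³ rhoLim Q σ x) = ratioLimit Q σ · β_Q(x)` — from
`rhoLim = Rβ Φ(σ³Rβ)` (`rhoLim_eq_mul_phi`), `Φ ∈ (1/2, 3/2)` (`abs_phi_sub_one_le`) and uniqueness of the root of
`R' Φ(x R') = 1` in `[1/2, 2]`. [folklore] -/
theorem rhoLim_mul_insertion {r : ℝ} {Rf : ℝ → ℝ}
    (huniq : ∀ x ∈ Ioo (-r) r, ∀ R ∈ Icc (1 / 2 : ℝ) 2,
      R * (∑' j : ℕ, bE j / (j.factorial : ℝ) * (x * R) ^ j) = 1 → R = Rf x)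
    {Q : DensityProfile} {σ : ℝ} (hQs : SmallDensity Q σ) (x : T3)
    (hmem : σ ^ 3 * rhoLim Q σ x ∈ Ioo (-r) r) :
    rhoLim Q σ x * Rf (σ ^ 3 * rhoLim Q σ x) = ratioLimit Q σ * Q.β x := by
  have hR := hQs.ratioLimit_mem
  have hR0 := hQs.ratioLimit_pos
  have hσ3 : 0 ≤ σ ^ 3 := (pow_pos hQs.σ_pos 3).le
  set R := ratioLimit Q σ with hRdef
  set u := σ ^ 3 * R * Q.β x with hu
  set Φu := ∑' j : ℕ, bE j / (j.factorial : ℝ) * u ^ j with hΦu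
  have hβ0 : 0 < Q.β x := Q.pos x
  have hu0 : 0 ≤ u := by positivity
  have huM : u ≤ 2 * Q.M * σ ^ 3 := by
    have h1 : R * Q.β x ≤ 2 * Q.M := mul_le_mul hR.2 (Q.le_M x) hβ0.le zero_le_two
    calc u = σ ^ 3 * (R * Q.β x) := by rw [hu]; ring
      _ ≤ σ ^ 3 * (2 * Q.M) := by gcongr
      _ = 2 * Q.M * σ ^ 3 := by ring
  have hΦ1 := abs_phi_sub_one_le hQs hu0 huM
  rw [← hΦu, abs_le] at hΦ1
  have hφ := hQs.phi_lt_half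
  have hΦlo : 1 / 2 < Φu := by linarith [hΦ1.1]
  have hΦhi : Φu < 3 / 2 := by linarith [hΦ1.2]
  have hΦpos : 0 < Φu := by linarith
  have hΦmem : Φu⁻¹ ∈ Icc (1 / 2 : ℝ) 2 := by
    constructor
    · rw [le_inv_comm₀ (by norm_num) hΦpos]; linarith
    · rw [inv_le_comm₀ hΦpos (by norm_num)]; linarith
  have hn : rhoLim Q σ x = R * Q.β x * Φu := rhoLim_eq_mul_phi Q σ x
  have hnσ : σ ^ 3 * rhoLim Q σ x = u * Φu := by rw [hn, hu]; ring
  have hRf : Φu⁻¹ = Rf (σ ^ 3 * rhoLim Q σ x) := by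
    refine huniq _ hmem _ hΦmem ?_
    rw [hnσ, show u * Φu * Φu⁻¹ = u from mul_inv_cancel_right₀ hΦpos.ne' u, ← hΦu]
    exact inv_mul_cancel₀ hΦpos.ne'
  rw [← hRf, hn, mul_assoc, mul_inv_cancel₀ hΦpos.ne', mul_one]

/-! ### §2 Uniqueness mod constants in the dilute class -/

section Core

variable {r : ℝ} {Rf : ℝ → ℝ} {η₂ : ℝ} (hr : 0 < r)
  (hsol : ∀ x ∈ Ioo (-r) r, 0 < Rf x ∧ Rf x * (∑' j : ℕ, bE j / (j.factorial : ℝ) * (x * Rf x) ^ j) = 1)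
  (hbd : ∀ x ∈ Icc 0 r, 1 ≤ Rf x ∧ Rf x ≤ 2) (hcont : ContinuousOn Rf (Icc 0 r))
  (huniq : ∀ x ∈ Ioo (-r) r, ∀ R ∈ Icc (1 / 2 : ℝ) 2,
    R * (∑' j : ℕ, bE j / (j.factorial : ℝ) * (x * R) ^ j) = 1 → R = Rf x)
  (hη₂ : 0 < η₂)
  (hexp : ∀ η ∈ Ioo 0 η₂, Real.exp (hsExcessFreeEnergy η + η * deriv hsExcessFreeEnergy η) = Rf η)
include hr hsol hbd hcont huniq hη₂ hexp

/-- **(iv′) UNIQUENESS MOD CONSTANTS IN THE DILUTE CLASS.** Under the hypotheses of `thermoActivity_spec`, for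
continuous `θ > 0`, `u`, and a continuous activity `a' > 0` obeying the activity-ratio guard
`σ³ · sup a' ≤ η₁ ∫ a'`: if along some flow family the empirical density field of the local Gibbs laws of
`(a', u, θ)` converges in probability to `ρ`, then `a'` is a constant multiple of `α_σ ∘ ρ`. Proof: `a'` is in the
statics regime, so its density field converges to `rhoLim (profileOf a') σ` (`densityLLN_of_smallDensity`);
limits in probability are unique, so `rhoLim (profileOf a') σ = ρ`; then `F_σ ∘ rhoLim = R' β'`
(`rhoLim_mul_insertion`) reads `α_σ(ρ(x)) = ρ(x) Rf(σ³ρ(x)) = R' a'(x)/∫a'`. [folklore] -/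
theorem thermoActivity_unique {σ : ℝ} (hσ : 0 < σ) {ρ : T3 → ℝ} (hρc : Continuous ρ)
    (hρ0 : ∀ x, 0 < ρ x) (hρ1 : (∫ x, ρ x) = 1) (hpack : ∀ x, ρ x * σ ^ 3 ≤ thresh r η₂)
    {θ : T3 → ℝ} {u : T3 → V3} (hθc : Continuous θ) (huc : Continuous u) (hθ0 : ∀ x, 0 < θ x)
    {a' : T3 → ℝ} (ha'c : Continuous a') (ha'0 : ∀ x, 0 < a' x)
    (hguard : σ ^ 3 * (⨆ x, a' x) ≤ thresh r η₂ * ∫ x, a' x)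
    (Φ : (N : ℕ) → HardSphereFlow (Torus.geometry (Fin 3)) (hsDiameter σ N) (N + 1))
    (hconv : ∀ χ : T3 → ℝ, Continuous χ → ∀ δ : ℝ, 0 < δ →
      Tendsto (fun N => localGibbsLaw σ a' u θ N (Φ N)
        {z | δ < |empiricalDensityField z χ - ∫ x, χ x * ρ x|}) atTop (𝓝 0)) :
    ∃ ζ : ℝ, 0 < ζ ∧ ∀ x, a' x = ζ * thermoActivity σ ρ x := by
  obtain ⟨hσ2, hα, -⟩ := thermoActivity_spec hr hsol hbd hcont huniq hη₂ hexp hσ hρc hρ0 hρ1 hpack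
  have he0 : 0 < Real.exp 1 := Real.exp_pos 1
  have hv : 0 < v₁ := v₁_pos
  have hσ3 : 0 < σ ^ 3 := pow_pos hσ 3
  set T := thresh r η₂ with hT
  have hT1 : T ≤ η₂ / 2 := (min_le_left _ _).trans (min_le_left _ _)
  have hT3 : T ≤ r / (2 * (2 * (2 * Real.exp 1 + 1))) := (min_le_right _ _).trans (min_le_left _ _)
  have hT4 : T ≤ 1 / (128 * Real.exp 1 * v₁) := (min_le_right _ _).trans (min_le_right _ _)
  -- the profile of `a'` is in the statics regime
  set P' := profileOf a' ha'c ha'0 with hP'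
  have hint' : 0 < ∫ x, a' x := integral_pos_of_continuous_pos ha'c ha'0
  have hbdd' : BddAbove (Set.range a') := (isCompact_range ha'c).bddAbove
  have hsup' : ∀ x, a' x ≤ ⨆ y, a' y := fun x => le_ciSup hbdd' x
  have hP'M : P'.M ≤ (⨆ y, a' y) / ∫ y, a' y := by
    refine csSup_le (Set.range_nonempty _) ?_
    rintro _ ⟨x, rfl⟩
    rw [hP', profileOf_β]
    exact div_le_div_of_nonneg_right (hsup' x) hint'.le
  have hMσ : P'.M * σ ^ 3 ≤ T := by
    calc P'.M * σ ^ 3 ≤ (⨆ y, a' y) / (∫ y, a' y) * σ ^ 3 := mul_le_mul_of_nonneg_right hP'M hσ3.le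
      _ = σ ^ 3 * (⨆ y, a' y) / ∫ y, a' y := by ring
      _ ≤ T * (∫ y, a' y) / ∫ y, a' y := div_le_div_of_nonneg_right hguard hint'.le
      _ = T := by field_simp
  have hsmall' : Real.exp 1 * (P'.M * v₁ * σ ^ 3) ≤ 1 / 32 := by
    calc Real.exp 1 * (P'.M * v₁ * σ ^ 3) = Real.exp 1 * v₁ * (P'.M * σ ^ 3) := by ring
      _ ≤ Real.exp 1 * v₁ * (1 / (128 * Real.exp 1 * v₁)) :=
          mul_le_mul_of_nonneg_left (hMσ.trans hT4) (by positivity)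
      _ = 1 / 128 := by field_simp
      _ ≤ 1 / 32 := by norm_num
  have hP's : SmallDensity P' σ := smallDensity_of_eta_le hσ hσ2 le_rfl hsmall'
  -- its density field converges to `rhoLim P' σ`, hence `rhoLim P' σ = ρ`
  have hdens := densityLLN_of_smallDensity ha'c ha'0 hP's
  have hPev : ∀ᶠ N in atTop, IsProbabilityMeasure (localGibbsMeasure σ a' u θ N) :=
    Eventually.of_forall fun N => isProbabilityMeasure_localGibbsMeasure ha'c hθc huc ha'0 hθ0 hσ2.le N
  have heq : rhoLim P' σ = ρ := by
    refine eq_of_forall_integral_mul_eq hP's.continuous_rhoLim hρc fun χ hχ => ?_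
    refine eq_of_tendsto_measure_lt_abs hPev
      (F := fun N (z : Config (N + 1) (Fin 3) T3) => ((N + 1 : ℕ) : ℝ)⁻¹ * ∑ i, χ (z i).1)
      (fun δ hδ => tendsto_localGibbsMeasure_densityEvent ha'c hθc huc (fun x => (ha'0 x).le) hθ0 σ hdens hχ hδ)
      (fun δ hδ => ?_)
    refine (hconv χ hχ δ hδ).congr fun N => ?_
    rw [localGibbsLaw_eq]
    congr 1
    ext z
    simp only [Set.mem_setOf_eq, empiricalDensityField_eq_sum]
  -- the representation `F_σ(ρ x) = R' β'(x)` at every point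
  have hR0 := hP's.ratioLimit_pos
  refine ⟨(∫ x, a' x) / ratioLimit P' σ, div_pos hint' hR0, fun x => ?_⟩
  have hmem : σ ^ 3 * rhoLim P' σ x ∈ Ioo (-r) r := by
    rw [heq]
    refine ⟨by nlinarith [mul_pos hσ3 (hρ0 x)], ?_⟩
    have hlt : r / (2 * (2 * (2 * Real.exp 1 + 1))) < r := by
      rw [div_lt_iff₀ (by positivity)]
      nlinarith
    calc σ ^ 3 * ρ x = ρ x * σ ^ 3 := mul_comm _ _
      _ ≤ T := hpack x
      _ < r := hT3.trans_lt hlt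
  have hrep := rhoLim_mul_insertion huniq hP's x hmem
  rw [heq] at hrep
  have hβx : P'.β x = a' x / ∫ y, a' y := by rw [hP', profileOf_β]
  rw [hα x, hrep, hβx]
  field_simp

end Core

/-! ### §3 The corrected hypothesis A and the registered helper stub -/

/-- **ACTIVITY INVERSION, DILUTE UNIQUENESS CLASS** (the corrected hypothesis A; signature of the registered helper
stub `stub_activityInversionDilute`): `ActivityInversion` with clause (iv) restricted to activities `a'` obeying the
activity-ratio guard `σ³ · sup a' ≤ η₁ ∫ a'` of `UniformLocalGibbsConcentration` (14445) — which is what the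
ledger's `t = 0` use supplies, since `RelEntropyVanishing` chooses `σ₀` AFTER the initial activity `a₀`. All else
verbatim. A THEOREM (`stub_activityInversionDilute`). -/
def ActivityInversionDilute : Prop :=
  ∃ η₁ : ℝ, 0 < η₁ ∧ ∀ σ : ℝ, 0 < σ →
    ∀ (ρ θ : T3 → ℝ) (u : T3 → V3), Continuous ρ → Continuous θ → Continuous u →
      (∀ x, 0 < ρ x) → (∀ x, 0 < θ x) → (∫ x, ρ x = 1) → (∀ x, ρ x * σ ^ 3 ≤ η₁) →
      (let a : T3 → ℝ := fun x => ρ x * Real.exp (hsExcessFreeEnergy (ρ x * σ ^ 3) +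
          ρ x * σ ^ 3 * deriv hsExcessFreeEnergy (ρ x * σ ^ 3))
       (∀ x, ρ x ≤ a x ∧ a x ≤ 2 * ρ x) ∧
       (∀ (N : ℕ) (Φ : HardSphereFlow (Torus.geometry (Fin 3)) (hsDiameter σ N) (N + 1)),
          IsProbabilityMeasure (localGibbsLaw σ a u θ N Φ)) ∧
       (∀ χ : T3 → ℝ, Continuous χ → ∀ δ : ℝ, 0 < δ → ∃ C : ℝ, 0 < C ∧
          ∀ (N : ℕ) (Φ : HardSphereFlow (Torus.geometry (Fin 3)) (hsDiameter σ N) (N + 1)),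
            localGibbsLaw σ a u θ N Φ {z | δ < |empiricalDensityField z χ - ∫ x, χ x * ρ x|} ≤
              ENNReal.ofReal (C * Real.exp (-(C⁻¹ * (N + 1)))) ∧
            localGibbsLaw σ a u θ N Φ {z | δ < ‖empiricalMomentumField z χ - ∫ x, (χ x * ρ x) • u x‖} ≤
              ENNReal.ofReal (C * Real.exp (-(C⁻¹ * (N + 1)))) ∧
            localGibbsLaw σ a u θ N Φ
                {z | δ < |empiricalEnergyField z χ - ∫ x, χ x * totalEnergyDensity (ρ x) (u x) (θ x)|} ≤
              ENNReal.ofReal (C * Real.exp (-(C⁻¹ * (N + 1))))) ∧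
       (∀ a' : T3 → ℝ, Continuous a' → (∀ x, 0 < a' x) → σ ^ 3 * (⨆ x, a' x) ≤ η₁ * ∫ x, a' x →
          (∃ Φ : (N : ℕ) → HardSphereFlow (Torus.geometry (Fin 3)) (hsDiameter σ N) (N + 1),
            ∀ χ : T3 → ℝ, Continuous χ → ∀ δ : ℝ, 0 < δ →
              Filter.Tendsto (fun N => localGibbsLaw σ a' u θ N (Φ N)
                {z | δ < |empiricalDensityField z χ - ∫ x, χ x * ρ x|}) Filter.atTop (nhds 0)) →
          ∃ ζ : ℝ, 0 < ζ ∧ ∀ x, a' x = ζ * a x))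

/-- **STUB `stub_activityInversionDilute`** (helper stub of line `dlr-block-transfer`, crux `KineticWindowGronwall`
stmt-AtomisticToContinuum-9282): activity inversion with dilute uniqueness, PROVED — `η₁ = thresh r η₂` for the
insertion-factor package of `insertionFactor_package`; (i), (ii) (`σ ≤ 1/2` is forced by `ρσ³ ≤ η₁ ≤ 1/16`,
`∫ρ = 1`), (iii) by `thermoActivity_concentration`, (iv′) by `thermoActivity_unique`. -/
theorem stub_activityInversionDilute : ActivityInversionDilute := by
  obtain ⟨r, hr, Rf, hsol, hbd, hcont, huniq, η₂, hη₂, -, hexp⟩ := insertionFactor_package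
  refine ⟨thresh r η₂, thresh_pos hr hη₂, fun σ hσ ρ θ u hρc hθc huc hρ0 hθ0 hρ1 hpack => ?_⟩
  obtain ⟨hσ2, -, ha, ha0, hale, -⟩ := thermoActivity_spec hr hsol hbd hcont huniq hη₂ hexp hσ hρc hρ0 hρ1 hpack
  refine ⟨hale, fun N Φ => isProbabilityMeasure_localGibbsLaw ha hθc huc ha0 hθ0 hσ2.le N Φ,
    fun χ hχ δ hδ => thermoActivity_concentration hr hsol hbd hcont huniq hη₂ hexp hσ hρc hρ0 hρ1 hpack hθc huc
      hθ0 hχ hδ,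
    fun a' ha'c ha'0 hguard hΦ => ?_⟩
  obtain ⟨Φ, hconv⟩ := hΦ
  exact thermoActivity_unique hr hsol hbd hcont huniq hη₂ hexp hσ hρc hρ0 hρ1 hpack hθc huc hθ0 ha'c ha'0 hguard
    Φ hconv

end Summit.AtomisticToContinuum.HydrodynamicLimit.Theorems.KineticWindowGronwallActivityInversion

end
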